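import Literature.Probability.RandomPlanarGeometry.CritPercSLESpaceFillingIffTraceEight
import Literature.Probability.RandomPlanarGeometry.LSW2004USTLemma46Forms
import HarnessLib

/-!
# The space-filling phase of SLE (Rohde–Schramm, Cor. 7.4 with the Update): decomposition into the two UST inputs of [LSW04] Thm. 4.7

Topic `Literature/Probability/RandomPlanarGeometry`; family `crit-perc` (crit-perc.S20).  The
named fact `Literature.Probability.RandomPlanarGeometry.ae_isSpaceFilling_sleTrace_of_eight_le`
(`CritPercSLE.lean`: for `κ ≥ 8` the SLE_κ trace is a.s. space-filling; S. Rohde, O. Schramm,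
Ann. of Math. 161 (2005), Cor. 7.4 and the Update for `κ = 8`) is a theorem of the tree at every
`κ ≠ 8` (`ae_isSpaceFilling_sleTrace_of_eight_le_of_ne_eight`) and at `κ = 8` is equivalent
(`ae_isSpaceFilling_sleTrace_of_eight_le_eight_iff`, `CritPercSLESpaceFillingIffTraceEight.lean`)
to `hasSLETrace_eight` — G. F. Lawler, O. Schramm, W. Werner, Ann. Probab. 32 (2004) [LSW04],
Thm. 4.7: chordal SLE₈ is generated by a continuous curve.  The tree proves Thm. 4.7
(`USTPeano.hasSLETrace_eight_of_lemma46diam_of_drivingProcess_tendsto`,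
`LSW2004USTLemma46Forms.lean`: Prop. 4.5 from Lemma 4.6, tightness, Prokhorov, the chordal
Lemma 3.14, the identification of the limit, and one approximating family of the disc) from the
two uniform-spanning-tree inputs of [LSW04] §4, which are therefore the leaves of the parent:

1. `USTPeano.drivingProcess_tendsto` (EXISTING named fact, `LSW2004UST.lean`) — [LSW04]
   Thm. 4.4 as used on p. 981: the Loewner driving process of the UST Peano curve converges in
   law to `B(8t)`;
2. `USTPeano.LawlerSchrammWerner2004_lemma46` (NEW named fact, this file) — [LSW04] Lemma 4.6
   (p. 978), the uniform-spanning-tree regularity estimate with `Y(t₁, t₂) =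
   diam(g_{t₁} ∘ γ̂[t₁, t₂])` as printed, verbatim the hypothesis `h46` of the landed
   reductions (its printed proof: Wilson's algorithm and Schramm (2000), Thms. 10.7, 11.1 (ii),
   Cor. 10.6 — a loop-erased-random-walk estimate, independent of the Loewner side).

Assemblies: `hasSLETrace_eight_holds_of` ([LSW04] Thm. 4.7 from the two leaves) and
`ae_isSpaceFilling_sleTrace_of_eight_le_holds_of` (the parent, every `κ`).  Neither child
restates the parent (a statement about the range of the SLE_κ trace, `κ ≥ 8`): (1) is a weak
convergence of driving processes of a discrete model, (2) a modulus-of-continuity estimate for the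
discrete Peano curve.

## References

* S. Rohde, O. Schramm, *Basic properties of SLE*, Ann. of Math. 161 (2005), 883–924: Cor. 7.4
  and the Update (p. 911). [RohdeSchramm2005]
* G. F. Lawler, O. Schramm, W. Werner, *Conformal invariance of planar loop-erased random walks
  and uniform spanning trees*, Ann. Probab. 32 (2004), 939–995: Thm. 4.4 (p. 976), Prop. 4.5
  (p. 977), Lemma 4.6 (p. 978), Thm. 4.7 (p. 981). [LawlerSchrammWerner2004]
* O. Schramm, *Scaling limits of loop-erased random walks and uniform spanning trees*, Israel J.
  Math. 118 (2000): Thms. 10.7, 11.1. [Schramm2000]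
-/

noncomputable section

open Set Filter MeasureTheory Metric Complex
open _root_.Topology
open UpperHalfPlane (upperHalfPlaneSet)
open scoped NNReal ENNReal

namespace Literature.Probability.RandomPlanarGeometry

namespace USTPeano

open scoped PathBorel

/-- **[LSW04] Lemma 4.6** (G. F. Lawler, O. Schramm, W. Werner, Ann. Probab. 32 (2004), p. 978),
in the setting of §4.3 (a smooth domain `D`, grid approximations `D^R` of `RD`, `γ = γ^R` the UST
Peano path of `D^R` under `P = ustLaw D^R`, `φ_R` the normalised map, `γ̂ := φ_R ∘ γ`
parametrised by capacity with driving function `W`, Loewner maps `g_t`): "For `0 < t₁ < t₂ < ∞`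
let `Y(t₁, t₂) := diam(g_{t₁} ∘ γ̂[t₁, t₂])`. For every `ε > 0` there is a `δ = δ(D, ε) > 0`
and an `R₀ = R₀(D, ε) > 0` such that for all `R ≥ R₀`,
`P[sup{|γ̂(t₂) - γ̂(t₁)| : 0 ≤ t₁ ≤ t₂ ≤ τ, Y(t₁, t₂) ≤ δ} ≥ ε] < ε`, where
`τ := inf{t ≥ 0 : |γ̂(t)| = ε⁻¹}`."  Rendering (that of `LSW2004USTLemma46Forms.lean`, whose
hypothesis `h46` this is verbatim): `g_{t₁} ∘ γ̂[t₁, t₂]` is the image of `[0, t₂ - t₁]` under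
the increment curve `Loewner.incrCurve W γ̂ t₁`, so `Y(t₁, t₂)` is its `Metric.ediam`;
"`t₂ ≤ τ`" is "`|γ̂(s)| < ε⁻¹` for all `s ≤ t₂`"; "`sup{…} ≥ ε`" is the sub-event "some
admissible pair `t₁ ≤ t₂` has `|γ̂(t₁) - γ̂(t₂)| ≥ ε`"; "`R ≥ R₀`" is "`R > R₀`"; universally over
the normalised maps `φ` and the (unique) capacity images — each a sub-event or weaker conclusion,
so this follows from the printed lemma.  Its printed proof uses Wilson's algorithm and the
loop-erased random walk estimates of Schramm (2000), Thm. 10.7, Cor. 10.6, Thm. 11.1 (ii), Lemma 2.1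
there. [cite: LawlerSchrammWerner2004, Lemma 4.6 (p. 978)] -/
def LawlerSchrammWerner2004_lemma46 : Prop :=
  ∀ (D : SmoothDomain) (ε : ℝ), 0 < ε →
    ∃ R₀ δ : ℝ, 0 < δ ∧ ∀ (R : ℝ) (Δ : Domain), R₀ < R → IsApproximation D R Δ →
      ∀ (φ : ConformalEquiv upperHalfPlaneSet Δ.carrier), Δ.IsLSWMap φ →
        ∀ (Γ : PeanoPath Δ → C(ℝ≥0, ℂ)) (W : PeanoPath Δ → C(ℝ≥0, ℝ)),
          (∀ γ, IsCapacityImage Δ φ γ (Γ γ) (W γ)) →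
            ustLaw Δ {γ | ∃ t₁ t₂ : ℝ≥0, t₁ ≤ t₂ ∧ (∀ s : ℝ≥0, s ≤ t₂ → ‖Γ γ s‖ < ε⁻¹) ∧
              Metric.ediam (Loewner.incrCurve (W γ) (Γ γ) t₁ '' Icc 0 (t₂ - t₁)) ≤
                ENNReal.ofReal δ ∧
              ε ≤ dist (Γ γ t₁) (Γ γ t₂)} < ENNReal.ofReal ε

/-- **Assembly: [LSW04] Thm. 4.7 (chordal SLE₈ is generated by a continuous curve,
`hasSLETrace_eight`) from its two UST inputs**, Lemma 4.6 as printed and Thm. 4.4 as used on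
p. 981, by `hasSLETrace_eight_of_lemma46diam_of_drivingProcess_tendsto`
(`LSW2004USTLemma46Forms.lean`). [cite: LawlerSchrammWerner2004, Thm. 4.7 (p. 981)] -/
theorem hasSLETrace_eight_holds_of :
    LawlerSchrammWerner2004_lemma46 → drivingProcess_tendsto → hasSLETrace_eight :=
  fun h46 h44 => hasSLETrace_eight_of_lemma46diam_of_drivingProcess_tendsto h46 h44

end USTPeano

/-- **Assembly: the space-filling phase `ae_isSpaceFilling_sleTrace_of_eight_le` (Rohde–Schramm
2005, Cor. 7.4 with the Update, every `κ`) from the two UST inputs of [LSW04] Thm. 4.7** —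
Lemma 4.6 and Thm. 4.4 — through `USTPeano.hasSLETrace_eight_holds_of` and
`ae_isSpaceFilling_sleTrace_of_eight_le_of_hasSLETrace_eight`
(`CritPercSLESpaceFillingIffTraceEight.lean`; Cor. 3.5, Thm. 7.1 and Cor. 7.4 of Rohde–Schramm
being theorems of the tree). [cite: RohdeSchramm2005, Cor. 7.4 and Update (p. 911)] -/
theorem ae_isSpaceFilling_sleTrace_of_eight_le_holds_of {κ : ℝ≥0} :
    USTPeano.LawlerSchrammWerner2004_lemma46 → USTPeano.drivingProcess_tendsto →
      ae_isSpaceFilling_sleTrace_of_eight_le (κ := κ) :=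
  fun h46 h44 => ae_isSpaceFilling_sleTrace_of_eight_le_of_hasSLETrace_eight
    (USTPeano.hasSLETrace_eight_holds_of h46 h44)

end Literature.Probability.RandomPlanarGeometry
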